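import Summits.ResolutionOfSingularities.ResolutionOfSingularities.Theorems.EquisingularLiftEquisingularLiftNatResidueHypDefsE
import Summits.ResolutionOfSingularities.ResolutionOfSingularities.Theorems.EquisingularLiftEquisingularLiftNatEquinodalLift
import HarnessLib

/-!
# [OURS · L1 W4.5(b) · EL♮(3) · nose residue, door ν4 «EQUINODAL PLANAR NOSE», junction (D6-4) ⟶ (D6-1)]
# `EqCertAt₀`'s data at `n = 3` feed `Equinodal.exists_equinodal_lift`: ONE junction lemma for the rung

Cell `res-hironaka`, rung L, slot W4.5(b); crux CHILD EL♮(3) = stmt-ResolutionOfSingularities-20148.  WIDTH seat res-L1-w45b-nose-w1 g3 (desk R52/R56 rows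
(D6-1) ✓ p670351 and (D6-4) `…NatResidueHypDefsE`).  For the rung author (D6-6, lead-2) and the engine wiring (D6-5, stub-2): after
`obtain ⟨e, δ, g, B, c, a, b, v, hg, hsq, hZ, hℓ, hrank, hcab, hmarked, hcover, hcert⟩ := (h : EqCertAt₀ k 3 ℓ Z hZ)` the lemma
`Equinodal.exists_equinodal_lift_of_cert g hg B c a b hcab v hmarked hcert` returns the equinodal `O`-lift of the reduced nose equation
`ḡ := restrictToHyperplane B g` with `O`-valued node vectors in the chart `x₂ = 1` (the global chart `(c, a, b) = (2, 0, 1)` of `EqCertAt₀` IS the input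
convention of the supplier, so the junction is `Fin.ext`).  Also the owed lemma (res-L1-w45b-idea-3 l.≈83780): `isHomogeneous_restrictToHyperplane`.
`--supports stmt-ResolutionOfSingularities-20148 --as helper`, counted 0.  OURS; nothing of [Hironaka2017]; AI-written, weaker than expert review; DEF-FREE,
no `sorry`, standard axioms; EL♮(3) NOT proved; resolution in positive characteristic NOT proved (dim 3 = Cossart–Piltant 2008/2009).
-/

set_option linter.dupNamespace false

noncomputable section

namespace Summit.ResolutionOfSingularities.ResolutionOfSingularities.Cruxes.EquisingularLiftNat.Sections.Equinodal

open MvPolynomial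

/-- Restriction to a hyperplane (a LINEAR substitution `x_a ↦ Σ_j B a j · X_j`) preserves homogeneity and the degree. -/
theorem isHomogeneous_restrictToHyperplane {k : Type} [Field k] {n : ℕ} (B : Fin (n + 1) → Fin n → k)
    (g : MvPolynomial (Fin (n + 1)) k) {e : ℕ} (hg : g.IsHomogeneous e) :
    (restrictToHyperplane B g).IsHomogeneous e := by
  have h := hg.aeval (fun a : Fin (n + 1) => ∑ j : Fin n, C (B a j) * X j) (n := 1) (fun a => ?_)
  · simpa [restrictToHyperplane] using h
  · refine IsHomogeneous.sum _ _ _ fun j _ => ?_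
    exact (isHomogeneous_X k j).C_mul (B a j)

/-- **THE n = 3 JUNCTION (D6-3 Props ⟶ D6-1 supplier).** The data of `EqCertAt₀ k 3 ℓ Z hZ` — a degree-`e` form `g` on `ℙ³`, hyperplane
coordinates `B`, the global chart `(c, a, b)` with `(c, a, b).val = (2, 0, 1)`, marked vectors `v` (chart, `g|_Π = ∇ g|_Π = 0`, Hessian block `≠ 0`) and the
surjectivity (CERT-EQ) — is EXACTLY the input of `Equinodal.exists_equinodal_lift` for `ḡ := restrictToHyperplane B g`: so over any local ring `O` complete
for its maximal ideal with residue field `k`, the nose equation lifts EQUINODALLY with `O`-valued node vectors.  The rung (D6-6) `obtain`s the conjuncts of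
`EqCertAt₀` and calls this lemma once. [OURS · junction of desk R52 rows (D6-4)/(D6-1); counted 0] -/
theorem exists_equinodal_lift_of_cert
    {O : Type} [CommRing O] [IsLocalRing O] [IsAdicComplete (IsLocalRing.maximalIdeal O) O] {e δ : ℕ}
    (g : MvPolynomial (Fin (3 + 1)) (IsLocalRing.ResidueField O)) (hg : g.IsHomogeneous e)
    (B : Fin (3 + 1) → Fin 3 → IsLocalRing.ResidueField O) (c a b : Fin 3)
    (hcab : (c : ℕ) = 2 ∧ (a : ℕ) = 0 ∧ (b : ℕ) = 1) (v : Fin δ → Fin 3 → IsLocalRing.ResidueField O)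
    (hmarked : ∀ i, v i c = 1 ∧
      MvPolynomial.eval (v i) (restrictToHyperplane B g) = 0 ∧
      (∀ j, MvPolynomial.eval (v i) (MvPolynomial.pderiv j (restrictToHyperplane B g)) = 0) ∧
      hessBlock (restrictToHyperplane B g) a b (v i) ≠ 0)
    (hcert : Function.Surjective (fun h : MvPolynomial.homogeneousSubmodule (Fin 3) (IsLocalRing.ResidueField O) e =>
      fun i => MvPolynomial.eval (v i) (h : MvPolynomial (Fin 3) (IsLocalRing.ResidueField O)))) :
    ∃ (G : MvPolynomial (Fin 3) O) (nO : Fin δ → Fin 3 → O),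
      G.IsHomogeneous e ∧ MvPolynomial.map (IsLocalRing.residue O) G = restrictToHyperplane B g ∧
      (∀ i j, IsLocalRing.residue O (nO i j) = v i j) ∧ (∀ i, nO i 2 = 1) ∧
      (∀ i, MvPolynomial.eval (nO i) G = 0 ∧ ∀ j, MvPolynomial.eval (nO i) (MvPolynomial.pderiv j G) = 0) ∧
      (∀ i, IsUnit (MvPolynomial.eval (nO i) (MvPolynomial.pderiv 0 (MvPolynomial.pderiv 0 G)) *
          MvPolynomial.eval (nO i) (MvPolynomial.pderiv 1 (MvPolynomial.pderiv 1 G))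
        - MvPolynomial.eval (nO i) (MvPolynomial.pderiv 0 (MvPolynomial.pderiv 1 G)) ^ 2)) := by
  obtain ⟨hc, ha, hb⟩ := hcab
  have hc' : c = 2 := Fin.ext hc
  have ha' : a = 0 := Fin.ext ha
  have hb' : b = 1 := Fin.ext hb
  subst hc' ha' hb'
  exact exists_equinodal_lift (restrictToHyperplane B g) (isHomogeneous_restrictToHyperplane B g hg) v
    (fun i => (hmarked i).1) (fun i => ⟨(hmarked i).2.1, (hmarked i).2.2.1⟩) (fun i => (hmarked i).2.2.2) hcert

end Summit.ResolutionOfSingularities.ResolutionOfSingularities.Cruxes.EquisingularLiftNat.Sections.Equinodal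

end
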